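import Summits.ValiantsHypothesis.ValiantsHypothesis.Theorems.FreeSubtorusOrbitDimensionBoundStubStableReductionBiorthogonal
import Summits.ValiantsHypothesis.ValiantsHypothesis.Theorems.FreeSubtorusOrbitDimensionBoundStubStableReductionSubpencils
import Summits.ValiantsHypothesis.ValiantsHypothesis.Theorems.FreeSubtorusOrbitDimensionBoundStubDiagonalLiftsDivisible

/-!
# `OrbitDimensionBound` (stmt-ValiantsHypothesis-16133), rung line `square_covering` — stub `stub_stableReduction`,
# infrastructure: the ORBIT argument — a local direct summand of an equivariant pencil is equivariant for a
# divisible torus (plan step I2c/I2d)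

Fifth helper file toward stub 1 `stub_stableReduction` (plan HOME/lmr/NOTE-p4g12-16133-stableReduction-plan.md).
Krull–Schmidt without decompositions, continued from `…StubStableReductionBiorthogonal`:

* §1 twisting by a substitution `γ`: morphisms (`hom_twist`, `hom_untwist`), retract data along a lift of `γ`
  (`retract_twist`), symmetry of isomorphisms (`iso_symm`);
* §2 `exists_iso_twist_pow` — if `δ` lifts to `M` and `N` is a LOCAL retract of `M` (size `k₀ ≥ 1`), then
  `N ≅ N(δ^p ·)` for some `1 ≤ p ≤ m`: otherwise the twists `N(δ^i ·)`, `i ≤ m`, are pairwise non-isomorphic local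
  retracts of `M`, which by the biorthogonal exchange (`exists_biorthogonal_extension`) carry a biorthogonal family of
  `m + 1` retracts of size `k₀`, contradicting `card_mul_le_of_biorthogonal`;  `iso_twist_pow_mul` iterates it;
* §3 **`exists_lifts_of_local_retract`** — consequently, for a subgroup `Γ` of substitutions all lifting to `M` and
  `m!`-DIVISIBLE (`∀ γ ∈ Γ, ∃ δ ∈ Γ, δ^{m!} = γ`), every `γ ∈ Γ` lifts to the local retract `N`
  (`N(γ·x) = G N(x) H⁻¹`).

Helper mode (`--supports stmt-ValiantsHypothesis-16133 --as helper`).  Honest framing: infrastructure toward ONE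
registered stub of a dormant rung line whose core `stub_gradedPowerCount` is OPEN; `OrbitDimensionBound`,
`FreeSubtorus` and VP ≠ VNP are OPEN and not moved.

## References
* N. Jacobson, *Basic Algebra II*, 2nd ed. (1989), §3.4 (Krull–Schmidt) — orientation only.
* [LandsbergRessayre2017] J. M. Landsberg, N. Ressayre, Differential Geom. Appl. 55 (2017), §3.3.
-/

set_option linter.dupNamespace false

namespace Summit.ValiantsHypothesis.ValiantsHypothesis.Theorems.FreeSubtorusOrbitDimensionBound.SquareCovering

open Matrix MvPolynomial Finset Module.End
open Literature.Computability.AlgebraicComplexity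
open Summit.ValiantsHypothesis.ValiantsHypothesis.Theorems.FreeSubtorusOrbitDimensionBound.SignCovering.PerSummand

/-! ### §1 Twisting morphisms and retracts by a substitution -/

section Twist

variable {σ : Type*} [Fintype σ] [DecidableEq σ]

/-- Substitution of variables fixes constant (rectangular) matrices. [folklore] -/
theorem map_C_map_linSubst {p q : Type*} (γ : GL σ ℂ) (X : Matrix p q ℂ) :
    (X.map (C (σ := σ))).map (linSubst σ ℂ (γ : Matrix σ σ ℂ)) = X.map (C (σ := σ)) := by
  ext i j
  simp [Matrix.map_apply]

/-- **Twisting a morphism**: `X N₁ = N₂ Y` implies `X N₁(γ·) = N₂(γ·) Y` (`X`, `Y` constant, rectangular).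
[folklore] -/
theorem hom_twist {p q : Type*} [Fintype p] [Fintype q] (γ : GL σ ℂ) (N₁ : Matrix q q (MvPolynomial σ ℂ))
    (N₂ : Matrix p p (MvPolynomial σ ℂ)) (X Y : Matrix p q ℂ)
    (h : X.map (C (σ := σ)) * N₁ = N₂ * Y.map (C (σ := σ))) :
    X.map (C (σ := σ)) * Matrix.linSubstEntries γ N₁ = Matrix.linSubstEntries γ N₂ * Y.map (C (σ := σ)) := by
  have h1 := congrArg (fun A => A.map (linSubst σ ℂ (γ : Matrix σ σ ℂ))) h
  simp only [Matrix.map_mul, map_C_map_linSubst] at h1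
  exact h1

/-- **Untwisting a morphism**: the converse of `hom_twist` (apply `γ⁻¹`). [folklore] -/
theorem hom_untwist {p q : Type*} [Fintype p] [Fintype q] (γ : GL σ ℂ) (N₁ : Matrix q q (MvPolynomial σ ℂ))
    (N₂ : Matrix p p (MvPolynomial σ ℂ)) (X Y : Matrix p q ℂ)
    (h : X.map (C (σ := σ)) * Matrix.linSubstEntries γ N₁ = Matrix.linSubstEntries γ N₂ * Y.map (C (σ := σ))) :
    X.map (C (σ := σ)) * N₁ = N₂ * Y.map (C (σ := σ)) := by
  have h1 := hom_twist γ⁻¹ _ _ X Y h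
  rwa [Matrix.linSubstEntries_inv_linSubstEntries, Matrix.linSubstEntries_inv_linSubstEntries] at h1

/-- **Twisting retract data along a lift**: if `M(γ·x) = G M(x) H⁻¹` and `(v, u)` make `N` a retract of `M`, then
`(G⁻¹ v_W, H⁻¹ v_V ; u_W G, u_V H)` make `N(γ·x)` a retract of `M`. [folklore] -/
theorem retract_twist {m k₀ : ℕ} (γ : GL σ ℂ) (M : Matrix (Fin m) (Fin m) (MvPolynomial σ ℂ))
    (N : Matrix (Fin k₀) (Fin k₀) (MvPolynomial σ ℂ)) (G H : GL (Fin m) ℂ)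
    (hlift : Matrix.linSubstEntries γ M =
      (G : Matrix (Fin m) (Fin m) ℂ).map C * M * ((H⁻¹ : GL (Fin m) ℂ) : Matrix (Fin m) (Fin m) ℂ).map C)
    (vW vV : Matrix (Fin m) (Fin k₀) ℂ) (uW uV : Matrix (Fin k₀) (Fin m) ℂ)
    (hv : vW.map (C (σ := σ)) * N = M * vV.map (C (σ := σ)))
    (hu : uW.map (C (σ := σ)) * M = N * uV.map (C (σ := σ))) :
    (((G⁻¹ : GL (Fin m) ℂ) : Matrix (Fin m) (Fin m) ℂ) * vW).map (C (σ := σ)) * Matrix.linSubstEntries γ N =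
        M * ((((H⁻¹ : GL (Fin m) ℂ) : Matrix (Fin m) (Fin m) ℂ)) * vV).map (C (σ := σ)) ∧
      (uW * (G : Matrix (Fin m) (Fin m) ℂ)).map (C (σ := σ)) * M =
        Matrix.linSubstEntries γ N * (uV * (H : Matrix (Fin m) (Fin m) ℂ)).map (C (σ := σ)) := by
  have hv1 := hom_twist γ N M vW vV hv
  have hu1 := hom_twist γ M N uW uV hu
  rw [hlift] at hv1 hu1
  have hGiG : (((G⁻¹ : GL (Fin m) ℂ) : Matrix (Fin m) (Fin m) ℂ)).map (C (σ := σ)) *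
      (G : Matrix (Fin m) (Fin m) ℂ).map (C (σ := σ)) = 1 := by
    rw [← Matrix.map_mul, Units.inv_mul, Matrix.map_one C C_0 C_1]
  have hHiH : (((H⁻¹ : GL (Fin m) ℂ) : Matrix (Fin m) (Fin m) ℂ)).map (C (σ := σ)) *
      (H : Matrix (Fin m) (Fin m) ℂ).map (C (σ := σ)) = 1 := by
    rw [← Matrix.map_mul, Units.inv_mul, Matrix.map_one C C_0 C_1]
  constructor
  · rw [Matrix.map_mul, Matrix.mul_assoc, hv1, Matrix.map_mul]
    simp only [← Matrix.mul_assoc]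
    rw [hGiG, Matrix.one_mul]
  · rw [Matrix.map_mul, Matrix.map_mul, ← Matrix.mul_assoc (Matrix.linSubstEntries γ N), ← hu1]
    simp only [Matrix.mul_assoc]
    rw [hHiH, Matrix.mul_one]

omit [Fintype σ] [DecidableEq σ] in
/-- **Isomorphisms are symmetric**: from `X A = B Y` with `X' X = 1`, `Y' Y = 1` (square) one gets `X' B = A Y'` with
`X X' = 1`, `Y Y' = 1`. [folklore] -/
theorem iso_symm {k₀ : ℕ} (A B : Matrix (Fin k₀) (Fin k₀) (MvPolynomial σ ℂ)) (X Y X' Y' : Matrix (Fin k₀) (Fin k₀) ℂ)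
    (h : X.map (C (σ := σ)) * A = B * Y.map (C (σ := σ))) (hX : X' * X = 1) (hY : Y' * Y = 1) :
    X'.map (C (σ := σ)) * B = A * Y'.map (C (σ := σ)) ∧ X * X' = 1 ∧ Y * Y' = 1 := by
  have hYY' : Y * Y' = 1 := mul_eq_one_comm.1 hY
  refine ⟨?_, mul_eq_one_comm.1 hX, hYY'⟩
  calc X'.map (C (σ := σ)) * B = X'.map (C (σ := σ)) * B * (Y * Y').map (C (σ := σ)) := by
        rw [hYY', Matrix.map_one C C_0 C_1, Matrix.mul_one]
    _ = X'.map (C (σ := σ)) * (X.map (C (σ := σ)) * A) * Y'.map (C (σ := σ)) := by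
        rw [Matrix.map_mul, ← Matrix.mul_assoc, Matrix.mul_assoc _ B, ← h]
    _ = A * Y'.map (C (σ := σ)) := by
        rw [← Matrix.mul_assoc, ← Matrix.map_mul, hX, Matrix.map_one C C_0 C_1, Matrix.one_mul]

end Twist

/-! ### §2 The orbit of a local summand under a lifted substitution is short -/

section Orbit

variable {σ : Type*} [Fintype σ] [DecidableEq σ] {m k₀ : ℕ}

/-- **Some twist `N(δ^p ·)`, `1 ≤ p ≤ m`, is isomorphic to `N`** (local retract `N` of size `k₀ ≥ 1` of a pencil
`M` of size `m` to which `δ` lifts; only `u_W v_W = 1` is used).  Krull–Schmidt count via biorthogonal families.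
[folklore] -/
theorem exists_iso_twist_pow (M : Matrix (Fin m) (Fin m) (MvPolynomial σ ℂ))
    (N : Matrix (Fin k₀) (Fin k₀) (MvPolynomial σ ℂ)) (hk₀ : 0 < k₀)
    (hloc : ∀ g h : Matrix (Fin k₀) (Fin k₀) ℂ, g.map C * N = N * h.map C →
      ∃ μ : ℂ, IsNilpotent (g - μ • (1 : Matrix (Fin k₀) (Fin k₀) ℂ)) ∧ IsNilpotent (h - μ • (1 : Matrix (Fin k₀) (Fin k₀) ℂ)))
    (δ : GL σ ℂ) (G H : GL (Fin m) ℂ)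
    (hlift : Matrix.linSubstEntries δ M =
      (G : Matrix (Fin m) (Fin m) ℂ).map C * M * ((H⁻¹ : GL (Fin m) ℂ) : Matrix (Fin m) (Fin m) ℂ).map C)
    (vW vV : Matrix (Fin m) (Fin k₀) ℂ) (uW uV : Matrix (Fin k₀) (Fin m) ℂ)
    (hv : vW.map (C (σ := σ)) * N = M * vV.map (C (σ := σ)))
    (hu : uW.map (C (σ := σ)) * M = N * uV.map (C (σ := σ))) (huvW : uW * vW = 1) :
    ∃ p : ℕ, 1 ≤ p ∧ p ≤ m ∧ ∃ (X Y X' Y' : Matrix (Fin k₀) (Fin k₀) ℂ),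
      X.map (C (σ := σ)) * N = Matrix.linSubstEntries (δ ^ p) N * Y.map (C (σ := σ)) ∧ X' * X = 1 ∧ Y' * Y = 1 := by
  classical
  by_contra hcon
  push Not at hcon
  -- the twisted local retracts `N(δ^i ·)` of `M`
  set Nt : ℕ → Matrix (Fin k₀) (Fin k₀) (MvPolynomial σ ℂ) := fun i => Matrix.linSubstEntries (δ ^ i) N with hNt
  set vWt : ℕ → Matrix (Fin m) (Fin k₀) ℂ := fun i => (((G ^ i)⁻¹ : GL (Fin m) ℂ) : Matrix (Fin m) (Fin m) ℂ) * vW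
    with hvWt
  set vVt : ℕ → Matrix (Fin m) (Fin k₀) ℂ := fun i => (((H ^ i)⁻¹ : GL (Fin m) ℂ) : Matrix (Fin m) (Fin m) ℂ) * vV
    with hvVt
  set uWt : ℕ → Matrix (Fin k₀) (Fin m) ℂ := fun i => uW * ((G ^ i : GL (Fin m) ℂ) : Matrix (Fin m) (Fin m) ℂ) with huWt
  set uVt : ℕ → Matrix (Fin k₀) (Fin m) ℂ := fun i => uV * ((H ^ i : GL (Fin m) ℂ) : Matrix (Fin m) (Fin m) ℂ) with huVt
  have hvt : ∀ i, (vWt i).map (C (σ := σ)) * Nt i = M * (vVt i).map (C (σ := σ)) ∧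
      (uWt i).map (C (σ := σ)) * M = Nt i * (uVt i).map (C (σ := σ)) := fun i =>
    retract_twist (δ ^ i) M N (G ^ i) (H ^ i) (lift_pow M δ G H hlift i) vW vV uW uV hv hu
  have huvt : ∀ i, uWt i * vWt i = 1 := by
    intro i
    simp only [huWt, hvWt]
    rw [Matrix.mul_assoc, ← Matrix.mul_assoc ((G ^ i : GL (Fin m) ℂ) : Matrix (Fin m) (Fin m) ℂ), Units.mul_inv,
      Matrix.one_mul, huvW]
  have hloct : ∀ i, ∀ g h : Matrix (Fin k₀) (Fin k₀) ℂ, g.map C * Nt i = Nt i * h.map C →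
      ∃ μ : ℂ, IsNilpotent (g - μ • (1 : Matrix (Fin k₀) (Fin k₀) ℂ)) ∧
        IsNilpotent (h - μ • (1 : Matrix (Fin k₀) (Fin k₀) ℂ)) :=
    fun i g h hgh => hloc g h (hom_untwist (δ ^ i) N N g h hgh)
  -- pairwise non-isomorphic (else untwisting gives `N ≅ N(δ^p ·)` with `1 ≤ p ≤ m`)
  have hniso : ∀ i s : ℕ, i < s → s ≤ m → ¬ ∃ (X Y X' Y' : Matrix (Fin k₀) (Fin k₀) ℂ),
      X.map (C (σ := σ)) * Nt s = Nt i * Y.map (C (σ := σ)) ∧ X' * X = 1 ∧ Y' * Y = 1 := by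
    rintro i s his hsm ⟨X, Y, X', Y', hXY, hX, hY⟩
    have hs : Nt s = Matrix.linSubstEntries (δ ^ i) (Nt (s - i)) := by
      simp only [hNt]
      rw [Matrix.linSubstEntries_linSubstEntries, ← pow_add, Nat.add_sub_cancel' his.le]
    rw [hs] at hXY
    have h1 := hom_untwist (δ ^ i) (Nt (s - i)) N X Y hXY
    obtain ⟨h2, hXX', hYY'⟩ := iso_symm (Nt (s - i)) N X Y X' Y' h1 hX hY
    exact hcon (s - i) (by omega) (by omega) X' Y' X Y h2 hXX' hYY'
  -- biorthogonal families of every length `s ≤ m + 1`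
  have key : ∀ s : ℕ, s ≤ m + 1 → ∃ (a c : Fin s → Matrix (Fin m) (Fin k₀) ℂ) (b d : Fin s → Matrix (Fin k₀) (Fin m) ℂ),
      (∀ i : Fin s, (a i).map (C (σ := σ)) * Nt i = M * (c i).map (C (σ := σ))) ∧
      (∀ i : Fin s, (b i).map (C (σ := σ)) * M = Nt i * (d i).map (C (σ := σ))) ∧
      (∀ i j : Fin s, b i * a j = if i = j then 1 else 0) ∧ (∀ i j : Fin s, d i * c j = if i = j then 1 else 0) := by
    intro s
    induction s with
    | zero =>
      intro _
      exact ⟨fun i => Fin.elim0 i, fun i => Fin.elim0 i, fun i => Fin.elim0 i, fun i => Fin.elim0 i,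
        fun i => Fin.elim0 i, fun i => Fin.elim0 i, fun i => Fin.elim0 i, fun i => Fin.elim0 i⟩
    | succ s ih =>
      intro hs
      obtain ⟨a, c, b, d, ha, hb, hba, hdc⟩ := ih (Nat.le_of_succ_le hs)
      obtain ⟨wW, wV, zW, zV, hw, hz, hzw, hzwV, h1, h2, h3, h4⟩ :=
        exists_biorthogonal_extension M (fun i : Fin s => Nt i) (Nt s) hk₀ a c b d ha hb hba hdc
          (vWt s) (vVt s) (uWt s) (uVt s) (hvt s).1 (hvt s).2 (huvt s) (hloct s)
          (fun i => hniso i s i.is_lt (by omega))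
      refine ⟨fun i => Fin.lastCases wW a i, fun i => Fin.lastCases wV c i, fun i => Fin.lastCases zW b i,
        fun i => Fin.lastCases zV d i, fun i => ?_, fun i => ?_, fun i j => ?_, fun i j => ?_⟩
      · induction i using Fin.lastCases with
        | last => simp only [Fin.lastCases_last, Fin.val_last]; exact hw
        | cast i => simp only [Fin.lastCases_castSucc, Fin.val_castSucc]; exact ha i
      · induction i using Fin.lastCases with
        | last => simp only [Fin.lastCases_last, Fin.val_last]; exact hz
        | cast i => simp only [Fin.lastCases_castSucc, Fin.val_castSucc]; exact hb i
      · induction i using Fin.lastCases with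
        | last =>
          induction j using Fin.lastCases with
          | last => simp only [Fin.lastCases_last, if_true]; exact hzw
          | cast j =>
            simp only [Fin.lastCases_last, Fin.lastCases_castSucc]
            rw [if_neg (Fin.castSucc_lt_last j).ne']; exact h2 j
        | cast i =>
          induction j using Fin.lastCases with
          | last =>
            simp only [Fin.lastCases_last, Fin.lastCases_castSucc]
            rw [if_neg (Fin.castSucc_lt_last i).ne]; exact h1 i
          | cast j =>
            simp only [Fin.lastCases_castSucc, Fin.castSucc_inj]; exact hba i j
      · induction i using Fin.lastCases with
        | last =>
          induction j using Fin.lastCases with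
          | last => simp only [Fin.lastCases_last, if_true]; exact hzwV
          | cast j =>
            simp only [Fin.lastCases_last, Fin.lastCases_castSucc]
            rw [if_neg (Fin.castSucc_lt_last j).ne']; exact h4 j
        | cast i =>
          induction j using Fin.lastCases with
          | last =>
            simp only [Fin.lastCases_last, Fin.lastCases_castSucc]
            rw [if_neg (Fin.castSucc_lt_last i).ne]; exact h3 i
          | cast j =>
            simp only [Fin.lastCases_castSucc, Fin.castSucc_inj]; exact hdc i j
  -- the count
  obtain ⟨a, c, b, d, -, -, hba, -⟩ := key (m + 1) le_rfl
  have hle := card_mul_le_of_biorthogonal a b hba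
  have h1 : (m + 1) * 1 ≤ (m + 1) * k₀ := Nat.mul_le_mul_left (m + 1) hk₀
  omega

/-- Iterating an isomorphism `N ≅ N(δ^p ·)`: `N ≅ N(δ^{p j} ·)`. [folklore] -/
theorem iso_twist_pow_mul (N : Matrix (Fin k₀) (Fin k₀) (MvPolynomial σ ℂ)) (δ : GL σ ℂ) (p : ℕ)
    (h : ∃ (X Y X' Y' : Matrix (Fin k₀) (Fin k₀) ℂ),
      X.map (C (σ := σ)) * N = Matrix.linSubstEntries (δ ^ p) N * Y.map (C (σ := σ)) ∧ X' * X = 1 ∧ Y' * Y = 1)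
    (j : ℕ) :
    ∃ (X Y X' Y' : Matrix (Fin k₀) (Fin k₀) ℂ),
      X.map (C (σ := σ)) * N = Matrix.linSubstEntries (δ ^ (p * j)) N * Y.map (C (σ := σ)) ∧
        X' * X = 1 ∧ Y' * Y = 1 := by
  induction j with
  | zero =>
    refine ⟨1, 1, 1, 1, ?_, Matrix.mul_one 1, Matrix.mul_one 1⟩
    rw [mul_zero, pow_zero, Matrix.linSubstEntries_one, Matrix.map_one C C_0 C_1, Matrix.one_mul, Matrix.mul_one]
  | succ j ih =>
    obtain ⟨X, Y, X', Y', hXY, hX, hY⟩ := h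
    obtain ⟨X₁, Y₁, X₁', Y₁', h₁, hX₁, hY₁⟩ := ih
    have h₂ := hom_twist (δ ^ p) N (Matrix.linSubstEntries (δ ^ (p * j)) N) X₁ Y₁ h₁
    rw [Matrix.linSubstEntries_linSubstEntries, ← pow_add, show p + p * j = p * (j + 1) by ring] at h₂
    refine ⟨X₁ * X, Y₁ * Y, X' * X₁', Y' * Y₁', ?_, ?_, ?_⟩
    · rw [Matrix.map_mul, Matrix.mul_assoc, hXY, ← Matrix.mul_assoc, h₂, Matrix.mul_assoc, ← Matrix.map_mul]
    · rw [Matrix.mul_assoc, ← Matrix.mul_assoc X₁', hX₁, Matrix.one_mul, hX]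
    · rw [Matrix.mul_assoc, ← Matrix.mul_assoc Y₁', hY₁, Matrix.one_mul, hY]

/-! ### §3 Local summands of an equivariant pencil are equivariant for a divisible torus -/

/-- **A local direct summand of a `Γ`-equivariant pencil is `Γ`-equivariant when `Γ` is `m!`-divisible.**
[folklore] -/
theorem exists_lifts_of_local_retract (Γ : Subgroup (GL σ ℂ)) (M : Matrix (Fin m) (Fin m) (MvPolynomial σ ℂ))
    (N : Matrix (Fin k₀) (Fin k₀) (MvPolynomial σ ℂ)) (hk₀ : 0 < k₀)
    (hloc : ∀ g h : Matrix (Fin k₀) (Fin k₀) ℂ, g.map C * N = N * h.map C →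
      ∃ μ : ℂ, IsNilpotent (g - μ • (1 : Matrix (Fin k₀) (Fin k₀) ℂ)) ∧ IsNilpotent (h - μ • (1 : Matrix (Fin k₀) (Fin k₀) ℂ)))
    (hdiv : ∀ γ ∈ Γ, ∃ δ ∈ Γ, δ ^ (Nat.factorial m) = γ)
    (hlifts : ∀ γ ∈ Γ, ∃ G H : GL (Fin m) ℂ, Matrix.linSubstEntries γ M =
      (G : Matrix (Fin m) (Fin m) ℂ).map C * M * ((H⁻¹ : GL (Fin m) ℂ) : Matrix (Fin m) (Fin m) ℂ).map C)
    (vW vV : Matrix (Fin m) (Fin k₀) ℂ) (uW uV : Matrix (Fin k₀) (Fin m) ℂ)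
    (hv : vW.map (C (σ := σ)) * N = M * vV.map (C (σ := σ)))
    (hu : uW.map (C (σ := σ)) * M = N * uV.map (C (σ := σ))) (huvW : uW * vW = 1) :
    ∀ γ ∈ Γ, ∃ G H : GL (Fin k₀) ℂ, Matrix.linSubstEntries γ N =
      (G : Matrix (Fin k₀) (Fin k₀) ℂ).map C * N * ((H⁻¹ : GL (Fin k₀) ℂ) : Matrix (Fin k₀) (Fin k₀) ℂ).map C := by
  intro γ hγ
  obtain ⟨δ, hδ, rfl⟩ := hdiv γ hγ
  obtain ⟨G, H, hlift⟩ := hlifts δ hδ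
  obtain ⟨p, hp1, hpm, hiso⟩ := exists_iso_twist_pow M N hk₀ hloc δ G H hlift vW vV uW uV hv hu huvW
  obtain ⟨X, Y, X', Y', hXY, hX, hY⟩ := iso_twist_pow_mul N δ p hiso (Nat.factorial m / p)
  rw [Nat.mul_div_cancel' (Nat.dvd_factorial hp1 hpm)] at hXY
  have hYY' : Y * Y' = 1 := mul_eq_one_comm.1 hY
  have hXd : X.det ≠ 0 := by
    have h1 := congrArg Matrix.det hX
    rw [Matrix.det_mul, Matrix.det_one] at h1
    exact right_ne_zero_of_mul_eq_one h1
  refine exists_GL_lift_of_block (δ ^ Nat.factorial m) N X Y Y' hXd hY ?_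
  calc Matrix.linSubstEntries (δ ^ Nat.factorial m) N
      = Matrix.linSubstEntries (δ ^ Nat.factorial m) N * (Y * Y').map (C (σ := σ)) := by
        rw [hYY', Matrix.map_one C C_0 C_1, Matrix.mul_one]
    _ = X.map (C (σ := σ)) * N * Y'.map (C (σ := σ)) := by
        rw [Matrix.map_mul, ← Matrix.mul_assoc, ← hXY]

end Orbit

end Summit.ValiantsHypothesis.ValiantsHypothesis.Theorems.FreeSubtorusOrbitDimensionBound.SquareCovering
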